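import Summits.PneNP.PneNP.Theorems.ChebyshevTracialDesignAllDirectionsReduction
import HarnessLib

/-!
# Cell pnp-psdrank, route `ChebyshevTracialDesign`: (CG_1′) for COLOUR-SYMMETRIC masks reduces to the colour-type-constant directions plus the
# `r = 1` rung — brick 148 (crux `TracialDecayExp20`, stmt-PneNP-19878)

Brick 148 (prover g29; MEMO-32 §7). Bricks 145a/145b/145d/145 did this for ONE block `H` (masks `ψ(|U∩H|)`, three edge types). Nothing in the
reduction used more than: the mask is invariant under the vertex permutations that swap two edges of `M` of the same type. Here the block is replaced
by an arbitrary COLOURING `col : [n] → Fin k` and the mask by any cut function `f` invariant under colour-preserving relabelings (e.g.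
`f(U) = Ψ(|U∩H₁|, …, |U∩H_k|)` for the colour classes `H_j`); the edge type of `p` is the unordered pair `τ(p) = {col p, col πp} ∈ Sym2 (Fin k)`:
* §1 `pairKernel_perm_eq_of_invariant` (the pair kernel `A^f_M(p,q) = Σ_U W(U,M) f(U) x_px_{πp}x_qx_{πq}` satisfies `A(gp,gq) = A(p,q)` for every `g`
  commuting with `π_M` and fixing `f` — brick 145a's `designValue_map_eq`), **`exists_colour_swap`** (`(a b)(πa πb)` commutes with `π`, preserves every
  colour and maps `a ↦ b` when `col a = col b`, `col πa = col πb`, `b ∉ {a, πa}`);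
* §2 **`containment_le_colourTypeAvg_add_excess`** — per matching, for every pair-symmetric `c : [n] → [−1,1]` and its colour-type average `v`
  (`v(p)` = mean of `c` over `{q : τ q = τ p}`): `Σ_U W f C_c² ≤ Σ_U W f C_v² + 8·Σ_p Σ_{q∉{p,πp}} (A^f_M(p,p) − A^f_M(p,q))₊` (brick 145b with the ROW/BLOCK
  facts discharged by colour swaps; `Sym2.eq_iff` gives the aligned / crossed case split);
* §3 **`sum_colour_excess_le`** — `Σ_M Σ_p Σ_{q∉{p,πp}} (A^f_M(p,p) − A^f_M(p,q))₊ ≤ G·n⁶·γ` for `0 ≤ f ≤ G` whenever all rectangle sums of `W` are `≤ γ`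
  (brick 102 §2, the `r = 1` rung entrywise — verbatim brick 145d §2 for a general mask).
READING: for every colour-symmetric mask, the pair-containment statement (CG_1′) in ALL matching-dependent directions is EQUIVALENT, up to the
unconditional `r = 1` rung, to (CG_1′) in the `k(k+1)/2` colour-type-constant directions; for `k = 2` the latter is bricks 117–144 (⇒ brick 145); for
`k ≥ 3` (multi-block statistics) the type-constant part is open. WHAT THIS FILE DOES NOT DO: price any type-constant direction; anything on
`TracialDecayExp20` itself, psd rank of P_PM(K_n), or P vs NP. [cite: Rothvoss2017, §2 and Lemma 7 (PDF pp. 5–8)] [cite: GodsilMeagher2015, §15.2]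
[cite: KeevashLifshitz2023, Thm. 1.8]
Stature: support/instrument (kernel lane, no defs, axioms standard). Supports stmt-PneNP-19878.
-/

set_option linter.dupNamespace false -- `Summit.PneNP.PneNP.…`: summit = sub-problem (D-0017)

noncomputable section

namespace Summit.PneNP.PneNP.Theorems.ChebyshevTracialDesignColourSymmetricReduction

open Finset Literature.Barriers.PneNP Literature.Combinatorics.Optimization
open Literature.Combinatorics.Optimization.ShellStep
open Summit.PneNP.PneNP.Theorems.ChebyshevTracialDesignSwapSymmetry (designValue_map_eq mem_map_perm_iff)
open Summit.PneNP.PneNP.Theorems.ChebyshevTracialDesignTypeAveraging (quadForm_le_typeAvg_add_excess)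
open Summit.PneNP.PneNP.Theorems.ChebyshevTracialDesignAllDirectionsReduction (containment_eq_pairKernel)
open Summit.PneNP.PneNP.Theorems.ChebyshevTracialDesignPairContainmentEntrywise (sum_posPart_pairPinned_le)

variable {n k : ℕ}

/-! ### §1 Invariance of the pair kernel and colour swaps -/

/-- **The pair kernel of an invariant mask is invariant**: if `g` commutes with `π_M` and `f(gU) = f(U)` for all cuts, then
`A^f_M(gp, gq) = A^f_M(p, q)`. [cite: Rothvoss2017, §2 (PDF pp. 5–6)] -/
theorem pairKernel_perm_eq_of_invariant {t : ℕ} (ht : Odd t) (C : Finset ℕ) (w : ℕ → ℝ) (M : PMatch n) (f : Finset (Fin n) → ℝ)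
    (g : Equiv.Perm (Fin n)) (hgπ : ∀ i, g (M.2.partner i) = M.2.partner (g i)) (hgf : ∀ U : Finset (Fin n), f (U.map g.toEmbedding) = f U)
    (p q : Fin n) :
    ∑ U : OddSet n, levelWeight n t C w U M * (f U.1 *
        (((if g p ∈ U.1 then (1 : ℝ) else 0) * (if M.2.partner (g p) ∈ U.1 then (1 : ℝ) else 0)) *
          ((if g q ∈ U.1 then (1 : ℝ) else 0) * (if M.2.partner (g q) ∈ U.1 then (1 : ℝ) else 0)))) =
      ∑ U : OddSet n, levelWeight n t C w U M * (f U.1 *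
        (((if p ∈ U.1 then (1 : ℝ) else 0) * (if M.2.partner p ∈ U.1 then (1 : ℝ) else 0)) *
          ((if q ∈ U.1 then (1 : ℝ) else 0) * (if M.2.partner q ∈ U.1 then (1 : ℝ) else 0)))) := by
  rw [← designValue_map_eq ht C w M g hgπ (fun U => f U *
    (((if g p ∈ U then (1 : ℝ) else 0) * (if M.2.partner (g p) ∈ U then (1 : ℝ) else 0)) *
      ((if g q ∈ U then (1 : ℝ) else 0) * (if M.2.partner (g q) ∈ U then (1 : ℝ) else 0))))]
  refine Fintype.sum_congr _ _ fun U => ?_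
  simp only [hgf, ← hgπ, mem_map_perm_iff]

/-- **The swap of two same-colour-type edges.** For vertices `a, b` in different edges of `M` (`b ∉ {a, πa}`) with `col a = col b` and `col πa = col πb`,
the permutation `(a b)(πa πb)` commutes with `π`, preserves every colour, maps `a ↦ b`, and fixes every vertex outside `{a, b, πa, πb}`.
[cite: GodsilMeagher2015, §15.2] -/
theorem exists_colour_swap (M : PMatch n) (col : Fin n → Fin k) {a b : Fin n} (hba : b ≠ a) (hbπa : b ≠ M.2.partner a)
    (hab : col a = col b) (hπab : col (M.2.partner a) = col (M.2.partner b)) :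
    ∃ g : Equiv.Perm (Fin n), (∀ i, g (M.2.partner i) = M.2.partner (g i)) ∧ (∀ i, col (g i) = col i) ∧ g a = b ∧
      ∀ x, x ≠ a → x ≠ b → x ≠ M.2.partner a → x ≠ M.2.partner b → g x = x := by
  have hπ : ∀ v, M.2.partner (M.2.partner v) = v := partner_partner M
  have hπ' : ∀ v, M.2.partner v ≠ v := partner_ne M
  have d1 : M.2.partner a ≠ a := hπ' a
  have d2 : M.2.partner b ≠ b := hπ' b
  have d5 : M.2.partner b ≠ a := fun h => hbπa (by rw [← h, hπ])
  have d6 : M.2.partner b ≠ M.2.partner a := fun h => hba (by rw [← hπ b, h, hπ])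
  refine ⟨Equiv.swap a b * Equiv.swap (M.2.partner a) (M.2.partner b), ?_⟩
  have ga : (Equiv.swap a b * Equiv.swap (M.2.partner a) (M.2.partner b)) a = b := by
    rw [Equiv.Perm.mul_apply, Equiv.swap_apply_of_ne_of_ne d1.symm d5.symm, Equiv.swap_apply_left]
  have gb : (Equiv.swap a b * Equiv.swap (M.2.partner a) (M.2.partner b)) b = a := by
    rw [Equiv.Perm.mul_apply, Equiv.swap_apply_of_ne_of_ne hbπa d2.symm, Equiv.swap_apply_right]
  have gπa : (Equiv.swap a b * Equiv.swap (M.2.partner a) (M.2.partner b)) (M.2.partner a) = M.2.partner b := by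
    rw [Equiv.Perm.mul_apply, Equiv.swap_apply_left, Equiv.swap_apply_of_ne_of_ne d5 d2]
  have gπb : (Equiv.swap a b * Equiv.swap (M.2.partner a) (M.2.partner b)) (M.2.partner b) = M.2.partner a := by
    rw [Equiv.Perm.mul_apply, Equiv.swap_apply_right, Equiv.swap_apply_of_ne_of_ne d1 hbπa.symm]
  have gx : ∀ x, x ≠ a → x ≠ b → x ≠ M.2.partner a → x ≠ M.2.partner b →
      (Equiv.swap a b * Equiv.swap (M.2.partner a) (M.2.partner b)) x = x := by
    intro x h1 h2 h3 h4
    rw [Equiv.Perm.mul_apply, Equiv.swap_apply_of_ne_of_ne h3 h4, Equiv.swap_apply_of_ne_of_ne h1 h2]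
  refine ⟨?_, ?_, ga, gx⟩
  · intro i
    by_cases h1 : i = a
    · rw [h1, ga, gπa]
    by_cases h2 : i = b
    · rw [h2, gb, gπb]
    by_cases h3 : i = M.2.partner a
    · rw [h3, hπ, gπa, ga, hπ]
    by_cases h4 : i = M.2.partner b
    · rw [h4, hπ, gπb, gb, hπ]
    have k1 : M.2.partner i ≠ a := fun h => h3 (by rw [← h, hπ])
    have k2 : M.2.partner i ≠ b := fun h => h4 (by rw [← h, hπ])
    have k3 : M.2.partner i ≠ M.2.partner a := fun h => h1 (by rw [← hπ i, h, hπ])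
    have k4 : M.2.partner i ≠ M.2.partner b := fun h => h2 (by rw [← hπ i, h, hπ])
    rw [gx i h1 h2 h3 h4, gx _ k1 k2 k3 k4]
  · intro i
    by_cases h1 : i = a
    · rw [h1, ga]; exact hab.symm
    by_cases h2 : i = b
    · rw [h2, gb]; exact hab
    by_cases h3 : i = M.2.partner a
    · rw [h3, gπa]; exact hπab.symm
    by_cases h4 : i = M.2.partner b
    · rw [h4, gπb]; exact hπab
    rw [gx i h1 h2 h3 h4]

/-! ### §2 The per-matching reduction for colour-symmetric masks -/

/-- **THE PER-MATCHING REDUCTION FOR COLOUR-SYMMETRIC MASKS (brick 148).** For `t` odd, a matching `M`, a colouring `col`, a cut function `f`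
invariant under every colour-preserving relabeling commuting with `π_M`, a pair-symmetric direction `c : [n] → [−1,1]` and its colour-type average `v`
(edge type `τ(p) = {col p, col πp}`): `Σ_U W(U,M) f(U) C_c(U)² ≤ Σ_U W(U,M) f(U) C_v(U)² + 8·Σ_p Σ_{q∉{p,πp}} (A^f_M(p,p) − A^f_M(p,q))₊`.
[cite: Rothvoss2017, §2 (PDF pp. 5–6)] [cite: GodsilMeagher2015, §15.2] -/
theorem containment_le_colourTypeAvg_add_excess {t : ℕ} (ht : Odd t) (C : Finset ℕ) (w : ℕ → ℝ) (M : PMatch n) (col : Fin n → Fin k)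
    (f : Finset (Fin n) → ℝ)
    (hf : ∀ g : Equiv.Perm (Fin n), (∀ i, g (M.2.partner i) = M.2.partner (g i)) → (∀ i, col (g i) = col i) →
      ∀ U : Finset (Fin n), f (U.map g.toEmbedding) = f U)
    (τ : Fin n → Sym2 (Fin k)) (hτ : ∀ p, τ p = s(col p, col (M.2.partner p)))
    (c : Fin n → ℝ) (hcπ : ∀ p, c (M.2.partner p) = c p) (hc : ∀ p, |c p| ≤ 1) (v : Fin n → ℝ)
    (hv : ∀ p, v p = (∑ q ∈ univ.filter (fun q => τ q = τ p), c q) / ((univ.filter fun q => τ q = τ p).card : ℝ)) :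
    ∑ U : OddSet n, levelWeight n t C w U M * (f U.1 *
        (∑ p : Fin n, c p * ((if p ∈ U.1 then (1 : ℝ) else 0) * (if M.2.partner p ∈ U.1 then (1 : ℝ) else 0))) ^ 2) ≤
      ∑ U : OddSet n, levelWeight n t C w U M * (f U.1 *
        (∑ p : Fin n, v p * ((if p ∈ U.1 then (1 : ℝ) else 0) * (if M.2.partner p ∈ U.1 then (1 : ℝ) else 0))) ^ 2) +
      8 * ∑ p : Fin n, ∑ q ∈ univ.filter (fun q => q ≠ p ∧ q ≠ M.2.partner p),
        max (∑ U : OddSet n, levelWeight n t C w U M * (f U.1 *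
            (((if p ∈ U.1 then (1 : ℝ) else 0) * (if M.2.partner p ∈ U.1 then (1 : ℝ) else 0)) *
              ((if p ∈ U.1 then (1 : ℝ) else 0) * (if M.2.partner p ∈ U.1 then (1 : ℝ) else 0)))) -
          ∑ U : OddSet n, levelWeight n t C w U M * (f U.1 *
            (((if p ∈ U.1 then (1 : ℝ) else 0) * (if M.2.partner p ∈ U.1 then (1 : ℝ) else 0)) *
              ((if q ∈ U.1 then (1 : ℝ) else 0) * (if M.2.partner q ∈ U.1 then (1 : ℝ) else 0))))) 0 := by
  classical
  have hπ : ∀ v, M.2.partner (M.2.partner v) = v := partner_partner M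
  have hπ' : ∀ v, M.2.partner v ≠ v := partner_ne M
  -- the pair kernel
  obtain ⟨A, hA⟩ : ∃ A : Fin n → Fin n → ℝ, ∀ p q, A p q = ∑ U : OddSet n, levelWeight n t C w U M * (f U.1 *
      (((if p ∈ U.1 then (1 : ℝ) else 0) * (if M.2.partner p ∈ U.1 then (1 : ℝ) else 0)) *
        ((if q ∈ U.1 then (1 : ℝ) else 0) * (if M.2.partner q ∈ U.1 then (1 : ℝ) else 0)))) := ⟨_, fun _ _ => rfl⟩
  have hτπ : ∀ p, τ (M.2.partner p) = τ p := fun p => by rw [hτ, hτ, hπ, Sym2.eq_swap]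
  have hAs : ∀ p q, A p q = A q p := fun p q => by
    rw [hA, hA]; refine Fintype.sum_congr _ _ fun U => ?_; ring
  have hAπ : ∀ p q, A p (M.2.partner q) = A p q := fun p q => by
    rw [hA, hA]; refine Fintype.sum_congr _ _ fun U => ?_; rw [hπ]; ring
  have hinv : ∀ g : Equiv.Perm (Fin n), (∀ i, g (M.2.partner i) = M.2.partner (g i)) → (∀ i, col (g i) = col i) →
      ∀ p q, A (g p) (g q) = A p q := fun g hgπ hgc p q => by
    rw [hA, hA]; exact pairKernel_perm_eq_of_invariant ht C w M f g hgπ (hf g hgπ hgc) p q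
  have hτinv : ∀ g : Equiv.Perm (Fin n), (∀ i, g (M.2.partner i) = M.2.partner (g i)) → (∀ i, col (g i) = col i) →
      ∀ q, τ (g q) = τ q := fun g hgπ hgc q => by rw [hτ, hτ, ← hgπ, hgc, hgc]
  -- from `τ q = τ q'`: a colour swap with `g q ∈ {q', πq'}` fixing everything outside the two edges
  have hswap : ∀ q q' : Fin n, τ q = τ q' → q' ≠ q → q' ≠ M.2.partner q →
      ∃ g : Equiv.Perm (Fin n), (∀ i, g (M.2.partner i) = M.2.partner (g i)) ∧ (∀ i, col (g i) = col i) ∧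
        (g q = q' ∨ g q = M.2.partner q') ∧
        ∀ x, x ≠ q → x ≠ M.2.partner q → x ≠ q' → x ≠ M.2.partner q' → g x = x := by
    intro q q' hqq' h1 h2
    rw [hτ, hτ, Sym2.eq_iff] at hqq'
    rcases hqq' with ⟨ha, hb⟩ | ⟨ha, hb⟩
    · obtain ⟨g, hg1, hg2, hg3, hg4⟩ := exists_colour_swap M col h1 h2 ha hb
      exact ⟨g, hg1, hg2, Or.inl hg3, fun x hx1 hx2 hx3 hx4 => hg4 x hx1 hx3 hx2 hx4⟩
    · have h1' : M.2.partner q' ≠ q := fun h => h2 (by rw [← h, hπ])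
      have h2' : M.2.partner q' ≠ M.2.partner q := fun h => h1 (by rw [← hπ q', h, hπ])
      have hb' : col (M.2.partner q) = col (M.2.partner (M.2.partner q')) := by rw [hπ]; exact hb
      obtain ⟨g, hg1, hg2, hg3, hg4⟩ := exists_colour_swap M col h1' h2' ha hb'
      refine ⟨g, hg1, hg2, Or.inr hg3, fun x hx1 hx2 hx3 hx4 => hg4 x hx1 hx4 hx2 (by rw [hπ]; exact hx3)⟩
  -- ROW fact
  have hrow : ∀ p q q', q ≠ p → q ≠ M.2.partner p → q' ≠ p → q' ≠ M.2.partner p → τ q = τ q' → A p q = A p q' := by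
    intro p q q' hqp hqπ hq'p hq'π hqq'
    by_cases e1 : q' = q
    · rw [e1]
    by_cases e2 : q' = M.2.partner q
    · rw [e2, hAπ]
    obtain ⟨g, hg1, hg2, hg3, hg4⟩ := hswap q q' hqq' e1 e2
    have hp1 : p ≠ M.2.partner q := fun h => hqπ (by rw [h, hπ])
    have hp2 : p ≠ M.2.partner q' := fun h => hq'π (by rw [h, hπ])
    have hgp : g p = p := hg4 p (Ne.symm hqp) hp1 (Ne.symm hq'p) hp2
    have key := hinv g hg1 hg2 p q
    rw [hgp] at key
    rcases hg3 with h | h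
    · rw [← key, h]
    · rw [← key, h, hAπ]
  -- BLOCK fact
  have hB : ∀ p p', τ p = τ p' → ∀ k',
      ∑ q ∈ univ.filter (fun q => τ q = k'), A p q = ∑ q ∈ univ.filter (fun q => τ q = k'), A p' q := by
    intro p p' hpp' k'
    have hreidx : ∀ g : Equiv.Perm (Fin n), (∀ i, g (M.2.partner i) = M.2.partner (g i)) → (∀ i, col (g i) = col i) →
        ∀ r : Fin n, ∑ q ∈ univ.filter (fun q => τ q = k'), A r (g q) = ∑ q ∈ univ.filter (fun q => τ q = k'), A r q := by
      intro g hgπ hgc r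
      rw [sum_filter, sum_filter]
      have h := Equiv.sum_comp g (fun q => if τ q = k' then A r q else 0)
      simp only [hτinv g hgπ hgc] at h
      exact h
    by_cases e1 : p' = p
    · rw [e1]
    by_cases e2 : p' = M.2.partner p
    · refine sum_congr rfl fun q _ => ?_
      rw [e2, hAs (M.2.partner p) q, hAπ q p, hAs p q]
    obtain ⟨g, hg1, hg2, hg3, hg4⟩ := hswap p p' hpp' e1 e2
    rcases hg3 with h | h
    · rw [← hreidx g hg1 hg2 p', ← h]
      exact sum_congr rfl fun q _ => (hinv g hg1 hg2 p q).symm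
    · rw [← hreidx g hg1 hg2 p']
      refine sum_congr rfl fun q _ => ?_
      rw [← hinv g hg1 hg2 p q, h, hAs (M.2.partner p') (g q), hAπ (g q) p', hAs (g q) p']
  have key := quadForm_le_typeAvg_add_excess M.2.partner hπ' τ hτπ A hAs hAπ hrow hB c hcπ hc v hv
  simp only [hA] at key
  rw [containment_eq_pairKernel (levelWeight n t C w) M (fun U => f U.1) c,
    containment_eq_pairKernel (levelWeight n t C w) M (fun U => f U.1) v]
  exact key

/-! ### §3 The excess, summed over the matchings (general mask) -/

/-- **The diagonal excess of ANY bounded mask is priced by the `r = 1` rung, entrywise.** If every rectangle has `W`-mass `≤ γ` and `0 ≤ f ≤ G`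
(`G > 0`), then `Σ_M Σ_p Σ_{q∉{p,πp}} (A^f_M(p,p) − A^f_M(p,q))₊ ≤ G·n⁶·γ`. [cite: Rothvoss2017, §2 and Lemma 7 (PDF pp. 6–8)] [cite: KeevashLifshitz2023, Thm. 1.8] -/
theorem sum_colour_excess_le (W : OddSet n → PMatch n → ℝ) {γ : ℝ}
    (hR : ∀ (A : Finset (OddSet n)) (B : Finset (PMatch n)), ∑ U ∈ A, ∑ M ∈ B, W U M ≤ γ)
    (f : Finset (Fin n) → ℝ) {G : ℝ} (hG : 0 < G) (hf0 : ∀ U, 0 ≤ f U) (hfG : ∀ U, f U ≤ G) :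
    ∑ M : PMatch n, ∑ p : Fin n, ∑ q ∈ univ.filter (fun q => q ≠ p ∧ q ≠ M.2.partner p),
        max (∑ U : OddSet n, W U M * (f U.1 *
            (((if p ∈ U.1 then (1 : ℝ) else 0) * (if M.2.partner p ∈ U.1 then (1 : ℝ) else 0)) *
              ((if p ∈ U.1 then (1 : ℝ) else 0) * (if M.2.partner p ∈ U.1 then (1 : ℝ) else 0)))) -
          ∑ U : OddSet n, W U M * (f U.1 *
            (((if p ∈ U.1 then (1 : ℝ) else 0) * (if M.2.partner p ∈ U.1 then (1 : ℝ) else 0)) *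
              ((if q ∈ U.1 then (1 : ℝ) else 0) * (if M.2.partner q ∈ U.1 then (1 : ℝ) else 0))))) 0 ≤
      G * (n : ℝ) ^ 6 * γ := by
  classical
  -- the fixed cut functions `F_{q q'} = f(U)(1 − x_q x_{q'})/G ∈ [0,1]`
  set F : Fin n → Fin n → OddSet n → ℝ := fun q q' U =>
    f U.1 * (1 - (if q ∈ U.1 then (1 : ℝ) else 0) * (if q' ∈ U.1 then (1 : ℝ) else 0)) / G with hF
  have hF01 : ∀ q q' U, 0 ≤ F q q' U ∧ F q q' U ≤ 1 := by
    intro q q' U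
    rw [hF]; dsimp only
    have h1 := hf0 U.1; have h2 := hfG U.1
    constructor
    · apply div_nonneg _ hG.le; apply mul_nonneg h1; split_ifs <;> norm_num
    · rw [div_le_one hG]
      have : (1 - (if q ∈ U.1 then (1 : ℝ) else 0) * (if q' ∈ U.1 then (1 : ℝ) else 0)) ≤ 1 := by split_ifs <;> norm_num
      have h0 : 0 ≤ (1 - (if q ∈ U.1 then (1 : ℝ) else 0) * (if q' ∈ U.1 then (1 : ℝ) else 0)) := by split_ifs <;> norm_num
      nlinarith
  -- each excess term as a `G`-multiple of an `f_{q,πq}`-cell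
  have hterm : ∀ (M : PMatch n) (p q : Fin n),
      (∑ U : OddSet n, W U M * (f U.1 *
            (((if p ∈ U.1 then (1 : ℝ) else 0) * (if M.2.partner p ∈ U.1 then (1 : ℝ) else 0)) *
              ((if p ∈ U.1 then (1 : ℝ) else 0) * (if M.2.partner p ∈ U.1 then (1 : ℝ) else 0)))) -
          ∑ U : OddSet n, W U M * (f U.1 *
            (((if p ∈ U.1 then (1 : ℝ) else 0) * (if M.2.partner p ∈ U.1 then (1 : ℝ) else 0)) *
              ((if q ∈ U.1 then (1 : ℝ) else 0) * (if M.2.partner q ∈ U.1 then (1 : ℝ) else 0))))) =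
        G * ∑ U : OddSet n, W U M * (F q (M.2.partner q) U *
            (((if p ∈ U.1 then (1 : ℝ) else 0) * (if M.2.partner p ∈ U.1 then (1 : ℝ) else 0)) *
              ((if p ∈ U.1 then (1 : ℝ) else 0) * (if M.2.partner p ∈ U.1 then (1 : ℝ) else 0)))) := by
    intro M p q
    rw [← sum_sub_distrib, mul_sum]
    refine Fintype.sum_congr _ _ fun U => ?_
    have hyp : ((if p ∈ U.1 then (1 : ℝ) else 0) * (if M.2.partner p ∈ U.1 then (1 : ℝ) else 0)) *
        ((if p ∈ U.1 then (1 : ℝ) else 0) * (if M.2.partner p ∈ U.1 then (1 : ℝ) else 0)) =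
        (if p ∈ U.1 then (1 : ℝ) else 0) * (if M.2.partner p ∈ U.1 then (1 : ℝ) else 0) := by
      split_ifs <;> norm_num
    rw [hyp, hF]; dsimp only
    field_simp
  -- reindex the partner of `q` as a free vertex `q'`
  have hmax : ∀ (M : PMatch n) (p q : Fin n),
      max (G * ∑ U : OddSet n, W U M * (F q (M.2.partner q) U *
            (((if p ∈ U.1 then (1 : ℝ) else 0) * (if M.2.partner p ∈ U.1 then (1 : ℝ) else 0)) *
              ((if p ∈ U.1 then (1 : ℝ) else 0) * (if M.2.partner p ∈ U.1 then (1 : ℝ) else 0))))) 0 ≤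
        ∑ q' : Fin n, G * max (∑ U : OddSet n, W U M * (F q q' U *
            (((if p ∈ U.1 then (1 : ℝ) else 0) * (if M.2.partner p ∈ U.1 then (1 : ℝ) else 0)) *
              ((if p ∈ U.1 then (1 : ℝ) else 0) * (if M.2.partner p ∈ U.1 then (1 : ℝ) else 0))))) 0 := by
    intro M p q
    have hnn : ∀ q', 0 ≤ G * max (∑ U : OddSet n, W U M * (F q q' U *
            (((if p ∈ U.1 then (1 : ℝ) else 0) * (if M.2.partner p ∈ U.1 then (1 : ℝ) else 0)) *
              ((if p ∈ U.1 then (1 : ℝ) else 0) * (if M.2.partner p ∈ U.1 then (1 : ℝ) else 0))))) 0 :=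
      fun q' => mul_nonneg hG.le (le_max_right _ _)
    refine le_trans ?_ (single_le_sum (fun q' _ => hnn q') (mem_univ (M.2.partner q)))
    rw [max_le_iff]
    exact ⟨mul_le_mul_of_nonneg_left (le_max_left _ _) hG.le, hnn _⟩
  calc _ = ∑ M : PMatch n, ∑ p : Fin n, ∑ q ∈ univ.filter (fun q => q ≠ p ∧ q ≠ M.2.partner p),
        max (G * ∑ U : OddSet n, W U M * (F q (M.2.partner q) U *
            (((if p ∈ U.1 then (1 : ℝ) else 0) * (if M.2.partner p ∈ U.1 then (1 : ℝ) else 0)) *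
              ((if p ∈ U.1 then (1 : ℝ) else 0) * (if M.2.partner p ∈ U.1 then (1 : ℝ) else 0))))) 0 := by
          refine sum_congr rfl fun M _ => sum_congr rfl fun p _ => sum_congr rfl fun q _ => ?_
          rw [hterm]
    _ ≤ ∑ M : PMatch n, ∑ p : Fin n, ∑ q : Fin n, ∑ q' : Fin n, G * max (∑ U : OddSet n, W U M * (F q q' U *
            (((if p ∈ U.1 then (1 : ℝ) else 0) * (if M.2.partner p ∈ U.1 then (1 : ℝ) else 0)) *
              ((if p ∈ U.1 then (1 : ℝ) else 0) * (if M.2.partner p ∈ U.1 then (1 : ℝ) else 0))))) 0 := by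
          refine sum_le_sum fun M _ => sum_le_sum fun p _ => ?_
          refine le_trans (sum_le_sum fun q _ => hmax M p q) ?_
          refine sum_le_sum_of_subset_of_nonneg (filter_subset _ _) fun q _ _ => sum_nonneg fun q' _ => ?_
          exact mul_nonneg hG.le (le_max_right _ _)
    _ = ∑ q : Fin n, ∑ q' : Fin n, ∑ M : PMatch n, ∑ p : Fin n, G * max (∑ U : OddSet n, W U M * (F q q' U *
            (((if p ∈ U.1 then (1 : ℝ) else 0) * (if M.2.partner p ∈ U.1 then (1 : ℝ) else 0)) *
              ((if p ∈ U.1 then (1 : ℝ) else 0) * (if M.2.partner p ∈ U.1 then (1 : ℝ) else 0))))) 0 := by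
          calc _ = ∑ M : PMatch n, ∑ q : Fin n, ∑ p : Fin n, ∑ q' : Fin n, G * max (∑ U : OddSet n, W U M * (F q q' U *
                    (((if p ∈ U.1 then (1 : ℝ) else 0) * (if M.2.partner p ∈ U.1 then (1 : ℝ) else 0)) *
                    ((if p ∈ U.1 then (1 : ℝ) else 0) * (if M.2.partner p ∈ U.1 then (1 : ℝ) else 0))))) 0 :=
                sum_congr rfl fun M _ => sum_comm
            _ = ∑ q : Fin n, ∑ M : PMatch n, ∑ p : Fin n, ∑ q' : Fin n, G * max (∑ U : OddSet n, W U M * (F q q' U *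
                    (((if p ∈ U.1 then (1 : ℝ) else 0) * (if M.2.partner p ∈ U.1 then (1 : ℝ) else 0)) *
                    ((if p ∈ U.1 then (1 : ℝ) else 0) * (if M.2.partner p ∈ U.1 then (1 : ℝ) else 0))))) 0 := sum_comm
            _ = ∑ q : Fin n, ∑ M : PMatch n, ∑ q' : Fin n, ∑ p : Fin n, G * max (∑ U : OddSet n, W U M * (F q q' U *
                    (((if p ∈ U.1 then (1 : ℝ) else 0) * (if M.2.partner p ∈ U.1 then (1 : ℝ) else 0)) *
                    ((if p ∈ U.1 then (1 : ℝ) else 0) * (if M.2.partner p ∈ U.1 then (1 : ℝ) else 0))))) 0 :=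
                sum_congr rfl fun q _ => sum_congr rfl fun M _ => sum_comm
            _ = _ := sum_congr rfl fun q _ => sum_comm
    _ ≤ ∑ _q : Fin n, ∑ _q' : Fin n, G * ((n : ℝ) ^ 4 * γ) := by
          refine sum_le_sum fun q _ => sum_le_sum fun q' _ => ?_
          simp only [← mul_sum]
          refine mul_le_mul_of_nonneg_left ?_ hG.le
          -- the diagonal terms of brick 102's entrywise bound for the mask `f_{q q'}`
          have h102 := sum_posPart_pairPinned_le W hR (F q q') (hF01 q q')
          refine le_trans (sum_le_sum fun M _ => sum_le_sum fun p _ => ?_) h102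
          exact single_le_sum (f := fun p₂ => max (∑ U : OddSet n, W U M * (F q q' U *
            (((if p ∈ U.1 then (1 : ℝ) else 0) * (if M.2.partner p ∈ U.1 then (1 : ℝ) else 0)) *
              ((if p₂ ∈ U.1 then (1 : ℝ) else 0) * (if M.2.partner p₂ ∈ U.1 then (1 : ℝ) else 0))))) 0)
            (fun _ _ => le_max_right _ _) (mem_univ p)
    _ = G * (n : ℝ) ^ 6 * γ := by
          rw [sum_const, sum_const, card_univ, Fintype.card_fin, smul_smul, nsmul_eq_mul]; push_cast; ring

/-! ### §4 (v2) The `M`-summed reduction -/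

/-- **(CG_1′) FOR COLOUR-SYMMETRIC MASKS REDUCES TO THE COLOUR-TYPE-CONSTANT DIRECTIONS, `M`-SUMMED (brick 148 §4).** For `t` odd, a colouring
`col : [n] → Fin k`, a mask `0 ≤ f ≤ G` invariant under every colour-preserving relabeling commuting with the matching at hand, a weight
`W = levelWeight n t C w` all of whose rectangle sums are `≤ γ`, and EVERY pair-symmetric direction field `c : PM_n → [n] → [−1,1]`:
`Σ_M Σ_U W f C_{c_M}² ≤ Σ_M Σ_U W f C_{v_M}² + 8·G·n⁶·γ`, where `v_M` is the colour-type average of `c_M` (constant on each edge type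
`{col p, col π_Mp}`). [cite: Rothvoss2017, §2 and Lemma 7 (PDF pp. 5–8)] [cite: KeevashLifshitz2023, Thm. 1.8] -/
theorem colourSymmetric_allDirections_reduction {t : ℕ} (ht : Odd t) (C : Finset ℕ) (w : ℕ → ℝ) {γ : ℝ}
    (hR : ∀ (A : Finset (OddSet n)) (B : Finset (PMatch n)), ∑ U ∈ A, ∑ M ∈ B, levelWeight n t C w U M ≤ γ)
    (col : Fin n → Fin k) (f : Finset (Fin n) → ℝ) {G : ℝ} (hG0 : 0 ≤ G) (hf0 : ∀ U, 0 ≤ f U) (hfG : ∀ U, f U ≤ G)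
    (hf : ∀ (M : PMatch n) (g : Equiv.Perm (Fin n)), (∀ i, g (M.2.partner i) = M.2.partner (g i)) → (∀ i, col (g i) = col i) →
      ∀ U : Finset (Fin n), f (U.map g.toEmbedding) = f U)
    (c : PMatch n → Fin n → ℝ) (hc : ∀ M p, |c M p| ≤ 1) (hcπ : ∀ M p, c M (M.2.partner p) = c M p) :
    ∑ M : PMatch n, ∑ U : OddSet n, levelWeight n t C w U M * (f U.1 *
        (∑ p : Fin n, c M p * ((if p ∈ U.1 then (1 : ℝ) else 0) * (if M.2.partner p ∈ U.1 then (1 : ℝ) else 0))) ^ 2) ≤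
      ∑ M : PMatch n, ∑ U : OddSet n, levelWeight n t C w U M * (f U.1 *
        (∑ p : Fin n, ((∑ q ∈ univ.filter (fun q => s(col q, col (M.2.partner q)) = s(col p, col (M.2.partner p))), c M q) /
            ((univ.filter fun q => s(col q, col (M.2.partner q)) = s(col p, col (M.2.partner p))).card : ℝ)) *
          ((if p ∈ U.1 then (1 : ℝ) else 0) * (if M.2.partner p ∈ U.1 then (1 : ℝ) else 0))) ^ 2) +
      8 * G * (n : ℝ) ^ 6 * γ := by
  classical
  have hγ : 0 ≤ γ := by simpa using hR ∅ ∅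
  -- the degenerate case `G = 0`
  rcases eq_or_lt_of_le hG0 with hG | hG
  · have hf00 : ∀ U, f U = 0 := fun U => le_antisymm (by rw [hG]; exact hfG U) (hf0 U)
    simp only [hf00, zero_mul, mul_zero, sum_const_zero, ← hG]
    norm_num
  -- per matching: brick 148 §2 with `τ_M p = {col p, col π_M p}`
  have hred := fun M : PMatch n => containment_le_colourTypeAvg_add_excess ht C w M col f (hf M)
    (fun p => s(col p, col (M.2.partner p))) (fun p => rfl) (c M) (hcπ M) (hc M)
    (fun p => (∑ q ∈ univ.filter (fun q => s(col q, col (M.2.partner q)) = s(col p, col (M.2.partner p))), c M q) /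
      ((univ.filter fun q => s(col q, col (M.2.partner q)) = s(col p, col (M.2.partner p))).card : ℝ)) (fun p => rfl)
  have hsum := sum_le_sum fun M (_ : M ∈ (univ : Finset (PMatch n))) => hred M
  rw [sum_add_distrib, ← mul_sum] at hsum
  have hexc := sum_colour_excess_le (levelWeight n t C w) hR f hG hf0 hfG
  linarith

end Summit.PneNP.PneNP.Theorems.ChebyshevTracialDesignColourSymmetricReduction

end
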